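import Literature.MathematicalPhysics.QuantumLattice.TorusGroundStateParticleHole
import Literature.MathematicalPhysics.QuantumLattice.TorusLimitParticleHoleEnergyWords
import Literature.MathematicalPhysics.QuantumLattice.TorusSectorGibbsParticleHoleDictionary
import HarnessLib

/-!
# Pull-back of certified energy WORDS from the particle–hole image class to the electron-doped class
# (`T = 0` ground-state class and `T > 0` canonical class): windows on `e_{Φ(a,b,c)}`, `K₁`, `K₂`, `D`

Family `hubbard` (topic `MathematicalPhysics/QuantumLattice`); seat `hubbard-downfold-unc-2` (cell `pub/hubbard-downfold`, row
«FILLING direction of BOX → WORD», electron-doped half). The consumer-facing corollaries of `TorusGroundStateParticleHole`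
(`IsTorusLimitOf.forall_particleHole_of_sectorGroundStates`: every word for the record `T = 0` class at `(t, -t', U, 2 - n)` reads on
`ω ∘ α`), `TorusSectorGibbsParticleHole` (`IsTorusLimitOfMixture.forall_particleHole_of_sectorGibbs`, the same at `T > 0`) and
`TorusLimitParticleHoleEnergyWords` (`e_{Φ(a,b,c)}(ω ∘ α) = e_{Φ(a,-b,c)}(ω) + c(1 - n)`): a window CERTIFIED for the word
`e_{Φ(a,b,c)}` over the IMAGE class (hole-doped, reflected diagonal hopping — the columns the certifier actually runs) is a window
for the word `e_{Φ(a,-b,c)}` over the ORIGINAL (electron-doped) class, shifted by `-c(1 - n)`: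

* §1 `T = 0`: `IsTorusLimitOf.meanEnergy_mem_Icc_of_forall_image` (general `(a, b, c)`), and the three coordinates —
  `K₁(ω) ∈ [lo, hi]` from `K₁ ∈ [lo, hi]` on the image class, `K₂(ω) ∈ [-hi, -lo]` from `K₂ ∈ [lo, hi]`,
  `D(ω) ∈ [lo - (1 - n), hi - (1 - n)]` from `D ∈ [lo, hi]`;
* §2 `T > 0` (canonical sector Gibbs class at `β`): the same four statements.

Hypotheses on the side sequence of the electron-doped class: `Ls → ∞` eventually even with complementary record sectors
(`halfRectN (2 - n) (Ls j) + halfRectN n (Ls j) = (Ls j)²`, i.e. `n (Ls j)²/2 ∈ ℤ`; flag «PH-transported, even-tori subsequence»).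
HONEST LIMITS: the image-class window must hold along EVERY `Ls' → ∞` (the binder of the cells' words); no number is produced
here. Everything is PROVED; no definition, no named fact, no sorry.

## References
* E. H. Lieb, F. Y. Wu, Physica A 321 (2003) 1, §1 eq. (3). [cite: LiebWuPhysicaA2003, §1 eq. (3)]
* F. H. L. Essler et al. (2005), §2.2.4 eqs. (2.59)–(2.61). [cite: EsslerEtAl2005, §2.2.4 eqs. (2.59)–(2.61)]
* O. Bratteli, A. Kishimoto, D. W. Robinson, CMP 64 (1978) 41, §3. [cite: BratteliKishimotoRobinson1978, §3 (mean energy functional)]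

## Mathlib / tree search
REUSED: `IsTorusLimitOf.forall_particleHole_of_sectorGroundStates` (`TorusGroundStateParticleHole`);
`IsTorusLimitOfMixture.forall_particleHole_of_sectorGibbs` (`TorusSectorGibbsParticleHole`);
`IsTorusLimitOf.meanEnergy_particleHole_hubbardTTPrime_of_sectorGroundStates`,
`IsTorusLimitOfMixture.meanEnergy_particleHole_hubbardTTPrime_of_sectorGibbs`, `meanEnergy_hubbardTTPrime_smul`
(`TorusLimitParticleHoleEnergyWords`, `HubbardTTPrimeMeanEnergySupergradient`). Nothing of this shape before
(`lean search 'of_forall_image'`).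
-/

noncomputable section

namespace Literature.MathematicalPhysics.QuantumLattice

open Matrix Finset HubbardWave0 Literature.Probability.LatticeModels ThermodynamicLimit
open _root_.Filter
open scoped _root_.Topology ComplexOrder BigOperators

namespace InfVolFermionState

/-- `e_{Φ(0,-1,0)}(ω) = -K₂(ω)`. [cite: BratteliKishimotoRobinson1978, §3 (mean energy functional)] -/
private theorem meanEnergy_zero_neg_one_zero (ω : InfVolFermionState 2) :
    ω.meanEnergy (hubbardTTPrimeFermionInteraction 0 (-1) 0) 1 = -ω.meanEnergy (hubbardTTPrimeFermionInteraction 0 1 0) 1 := by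
  have h := ω.meanEnergy_hubbardTTPrime_smul (-1) 0 1 0
  rwa [mul_zero, mul_one, neg_one_mul] at h

/-! ### §1 `T = 0`: torus-limit sector ground states -/

section GroundStates

variable {t t' U : ℝ} {n : ℝ} {Ls : ℕ → ℕ} {ψ : ∀ L, Fock (Orb (FermionTorus 2 L))} {ω : InfVolFermionState 2}

/-- **Pull-back of an energy-word window, `T = 0`.** Let `0 ≤ n ≤ 2` and suppose the word `e_{Φ(a,b,c)}` is certified to lie in
`[lo, hi]` for EVERY torus-limit ground state of the record class at the image point `(t, -t', U, 2 - n)` (all `Ls' → ∞`). Then for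
every torus-limit ground state `ω` of the record class at `(t, t', U, n)` along eventually-even `Ls → ∞` with complementary sectors,
`e_{Φ(a,-b,c)}(ω) ∈ [lo - c(1 - n), hi - c(1 - n)]`. [cite: LiebWuPhysicaA2003, §1 eq. (3)] -/
theorem IsTorusLimitOf.meanEnergy_mem_Icc_of_forall_image (t t' U : ℝ) (hn0 : 0 ≤ n) (hn2 : n ≤ 2) (a b c : ℝ) {lo hi : ℝ}
    (hW : ∀ (ω' : InfVolFermionState 2) (Ls' : ℕ → ℕ) (ψ' : ∀ L, Fock (Orb (FermionTorus 2 L))),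
      Tendsto Ls' atTop atTop →
      (∀ j, IsGroundStateInSector (hubbardTorusTT' (Ls' j) t (-t') U) (rectN (2 - n) (Ls' j)) 0 (ψ' (Ls' j))) →
      (∀ j, star (ψ' (Ls' j)) ⬝ᵥ ψ' (Ls' j) = 1) → ω'.IsTorusLimitOf ψ' Ls' →
      ω'.meanEnergy (hubbardTTPrimeFermionInteraction a b c) 1 ∈ Set.Icc lo hi)
    (hLs : Tendsto Ls atTop atTop) (heven : ∀ᶠ j in atTop, Even (Ls j))
    (hadd : ∀ᶠ j in atTop, halfRectN (2 - n) (Ls j) + halfRectN n (Ls j) = Ls j ^ 2)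
    (hψ : ∀ j, IsGroundStateInSector (hubbardTorusTT' (Ls j) t t' U) (rectN n (Ls j)) 0 (ψ (Ls j)))
    (h1 : ∀ j, star (ψ (Ls j)) ⬝ᵥ ψ (Ls j) = 1) (hω : ω.IsTorusLimitOf ψ Ls) :
    ω.meanEnergy (hubbardTTPrimeFermionInteraction a (-b) c) 1 ∈ Set.Icc (lo - c * (1 - n)) (hi - c * (1 - n)) := by
  have himg : ω.particleHole.meanEnergy (hubbardTTPrimeFermionInteraction a b c) 1 ∈ Set.Icc lo hi :=
    hω.forall_particleHole_of_sectorGroundStates t t' U hn0 hn2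
      (P := fun ω' => ω'.meanEnergy (hubbardTTPrimeFermionInteraction a b c) 1 ∈ Set.Icc lo hi) hW hLs heven hadd hψ h1
  rw [hω.meanEnergy_particleHole_hubbardTTPrime_of_sectorGroundStates t t' U hn0 hLs hψ h1 heven a b c] at himg
  exact ⟨by linarith [himg.1], by linarith [himg.2]⟩

/-- **Kinetic word, `T = 0`**: a certified window `K₁ ∈ [lo, hi]` over the image class is the same window for `K₁` over the
electron-doped class. [cite: EsslerEtAl2005, §2.2.4 eqs. (2.59)–(2.61)] -/
theorem IsTorusLimitOf.kineticWord_mem_Icc_of_forall_image (t t' U : ℝ) (hn0 : 0 ≤ n) (hn2 : n ≤ 2) {lo hi : ℝ}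
    (hW : ∀ (ω' : InfVolFermionState 2) (Ls' : ℕ → ℕ) (ψ' : ∀ L, Fock (Orb (FermionTorus 2 L))),
      Tendsto Ls' atTop atTop →
      (∀ j, IsGroundStateInSector (hubbardTorusTT' (Ls' j) t (-t') U) (rectN (2 - n) (Ls' j)) 0 (ψ' (Ls' j))) →
      (∀ j, star (ψ' (Ls' j)) ⬝ᵥ ψ' (Ls' j) = 1) → ω'.IsTorusLimitOf ψ' Ls' →
      ω'.meanEnergy (hubbardTTPrimeFermionInteraction 1 0 0) 1 ∈ Set.Icc lo hi)
    (hLs : Tendsto Ls atTop atTop) (heven : ∀ᶠ j in atTop, Even (Ls j))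
    (hadd : ∀ᶠ j in atTop, halfRectN (2 - n) (Ls j) + halfRectN n (Ls j) = Ls j ^ 2)
    (hψ : ∀ j, IsGroundStateInSector (hubbardTorusTT' (Ls j) t t' U) (rectN n (Ls j)) 0 (ψ (Ls j)))
    (h1 : ∀ j, star (ψ (Ls j)) ⬝ᵥ ψ (Ls j) = 1) (hω : ω.IsTorusLimitOf ψ Ls) :
    ω.meanEnergy (hubbardTTPrimeFermionInteraction 1 0 0) 1 ∈ Set.Icc lo hi := by
  have h := hω.meanEnergy_mem_Icc_of_forall_image t t' U hn0 hn2 1 0 0 hW hLs heven hadd hψ h1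
  rwa [neg_zero, zero_mul, sub_zero, sub_zero] at h

/-- **Diagonal-hopping word, `T = 0`**: a certified window `K₂ ∈ [lo, hi]` over the image class gives `K₂(ω) ∈ [-hi, -lo]` over
the electron-doped class. [cite: EsslerEtAl2005, §2.2.4 eqs. (2.59)–(2.61)] -/
theorem IsTorusLimitOf.diagHopWord_mem_Icc_of_forall_image (t t' U : ℝ) (hn0 : 0 ≤ n) (hn2 : n ≤ 2) {lo hi : ℝ}
    (hW : ∀ (ω' : InfVolFermionState 2) (Ls' : ℕ → ℕ) (ψ' : ∀ L, Fock (Orb (FermionTorus 2 L))),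
      Tendsto Ls' atTop atTop →
      (∀ j, IsGroundStateInSector (hubbardTorusTT' (Ls' j) t (-t') U) (rectN (2 - n) (Ls' j)) 0 (ψ' (Ls' j))) →
      (∀ j, star (ψ' (Ls' j)) ⬝ᵥ ψ' (Ls' j) = 1) → ω'.IsTorusLimitOf ψ' Ls' →
      ω'.meanEnergy (hubbardTTPrimeFermionInteraction 0 1 0) 1 ∈ Set.Icc lo hi)
    (hLs : Tendsto Ls atTop atTop) (heven : ∀ᶠ j in atTop, Even (Ls j))
    (hadd : ∀ᶠ j in atTop, halfRectN (2 - n) (Ls j) + halfRectN n (Ls j) = Ls j ^ 2)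
    (hψ : ∀ j, IsGroundStateInSector (hubbardTorusTT' (Ls j) t t' U) (rectN n (Ls j)) 0 (ψ (Ls j)))
    (h1 : ∀ j, star (ψ (Ls j)) ⬝ᵥ ψ (Ls j) = 1) (hω : ω.IsTorusLimitOf ψ Ls) :
    ω.meanEnergy (hubbardTTPrimeFermionInteraction 0 1 0) 1 ∈ Set.Icc (-hi) (-lo) := by
  have h := hω.meanEnergy_mem_Icc_of_forall_image t t' U hn0 hn2 0 1 0 hW hLs heven hadd hψ h1
  rw [zero_mul, sub_zero, sub_zero, meanEnergy_zero_neg_one_zero] at h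
  exact ⟨by linarith [h.2], by linarith [h.1]⟩

/-- **On-site (double-occupancy) word, `T = 0`**: a certified window `D ∈ [lo, hi]` over the image class gives
`D(ω) ∈ [lo - (1 - n), hi - (1 - n)]` over the electron-doped class. [cite: EsslerEtAl2005, §2.2.4 eqs. (2.59)–(2.61)] -/
theorem IsTorusLimitOf.onSiteWord_mem_Icc_of_forall_image (t t' U : ℝ) (hn0 : 0 ≤ n) (hn2 : n ≤ 2) {lo hi : ℝ}
    (hW : ∀ (ω' : InfVolFermionState 2) (Ls' : ℕ → ℕ) (ψ' : ∀ L, Fock (Orb (FermionTorus 2 L))),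
      Tendsto Ls' atTop atTop →
      (∀ j, IsGroundStateInSector (hubbardTorusTT' (Ls' j) t (-t') U) (rectN (2 - n) (Ls' j)) 0 (ψ' (Ls' j))) →
      (∀ j, star (ψ' (Ls' j)) ⬝ᵥ ψ' (Ls' j) = 1) → ω'.IsTorusLimitOf ψ' Ls' →
      ω'.meanEnergy (hubbardTTPrimeFermionInteraction 0 0 1) 1 ∈ Set.Icc lo hi)
    (hLs : Tendsto Ls atTop atTop) (heven : ∀ᶠ j in atTop, Even (Ls j))
    (hadd : ∀ᶠ j in atTop, halfRectN (2 - n) (Ls j) + halfRectN n (Ls j) = Ls j ^ 2)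
    (hψ : ∀ j, IsGroundStateInSector (hubbardTorusTT' (Ls j) t t' U) (rectN n (Ls j)) 0 (ψ (Ls j)))
    (h1 : ∀ j, star (ψ (Ls j)) ⬝ᵥ ψ (Ls j) = 1) (hω : ω.IsTorusLimitOf ψ Ls) :
    ω.meanEnergy (hubbardTTPrimeFermionInteraction 0 0 1) 1 ∈ Set.Icc (lo - (1 - n)) (hi - (1 - n)) := by
  have h := hω.meanEnergy_mem_Icc_of_forall_image t t' U hn0 hn2 0 0 1 hW hLs heven hadd hψ h1
  rwa [neg_zero, one_mul] at h

end GroundStates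

/-! ### §2 `T > 0`: torus limits of the canonical sector Gibbs states -/

section Thermal

variable {β t t' U : ℝ} {n : ℝ} {Ls : ℕ → ℕ} {ω : InfVolFermionState 2}

/-- **Pull-back of an energy-word window, `T > 0`.** Let `0 ≤ n ≤ 2` and suppose `e_{Φ(a,b,c)} ∈ [lo, hi]` for EVERY torus limit
of the canonical sector Gibbs class at the image point `(t, -t', U, 2 - n, β)` (all `Ls' → ∞`). Then for every torus limit `ω` of
the canonical class at `(t, t', U, n, β)` along eventually-even `Ls → ∞` with complementary sectors,
`e_{Φ(a,-b,c)}(ω) ∈ [lo - c(1 - n), hi - c(1 - n)]`. [cite: LiebWuPhysicaA2003, §1 eq. (3)] -/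
theorem IsTorusLimitOfMixture.meanEnergy_mem_Icc_of_forall_image (β t t' U : ℝ) (hn0 : 0 ≤ n) (hn2 : n ≤ 2) (a b c : ℝ)
    {lo hi : ℝ}
    (hW : ∀ (Ls' : ℕ → ℕ) (ω' : InfVolFermionState 2), Tendsto Ls' atTop atTop →
      ω'.IsTorusLimitOfMixture (sectorGibbsCount (2 - n)) (fun L => sectorGibbsWeightTT' β t (-t') U (2 - n) L)
        (fun L => sectorGibbsVectorTT' t (-t') U (2 - n) L) Ls' →
      ω'.meanEnergy (hubbardTTPrimeFermionInteraction a b c) 1 ∈ Set.Icc lo hi)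
    (hLs : Tendsto Ls atTop atTop) (heven : ∀ᶠ j in atTop, Even (Ls j))
    (hadd : ∀ᶠ j in atTop, halfRectN (2 - n) (Ls j) + halfRectN n (Ls j) = Ls j ^ 2)
    (hω : ω.IsTorusLimitOfMixture (sectorGibbsCount n) (fun L => sectorGibbsWeightTT' β t t' U n L)
      (fun L => sectorGibbsVectorTT' t t' U n L) Ls) :
    ω.meanEnergy (hubbardTTPrimeFermionInteraction a (-b) c) 1 ∈ Set.Icc (lo - c * (1 - n)) (hi - c * (1 - n)) := by
  have himg : ω.particleHole.meanEnergy (hubbardTTPrimeFermionInteraction a b c) 1 ∈ Set.Icc lo hi :=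
    hω.forall_particleHole_of_sectorGibbs β t t' U n
      (P := fun ω' => ω'.meanEnergy (hubbardTTPrimeFermionInteraction a b c) 1 ∈ Set.Icc lo hi) hW hLs heven hadd
  rw [hω.meanEnergy_particleHole_hubbardTTPrime_of_sectorGibbs β t t' U hn0 hn2 hLs heven a b c] at himg
  exact ⟨by linarith [himg.1], by linarith [himg.2]⟩

/-- **Kinetic word, `T > 0`**: `K₁ ∈ [lo, hi]` over the image class ⇒ `K₁(ω) ∈ [lo, hi]`. [cite: EsslerEtAl2005, §2.2.4 eqs. (2.59)–(2.61)] -/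
theorem IsTorusLimitOfMixture.kineticWord_mem_Icc_of_forall_image (β t t' U : ℝ) (hn0 : 0 ≤ n) (hn2 : n ≤ 2) {lo hi : ℝ}
    (hW : ∀ (Ls' : ℕ → ℕ) (ω' : InfVolFermionState 2), Tendsto Ls' atTop atTop →
      ω'.IsTorusLimitOfMixture (sectorGibbsCount (2 - n)) (fun L => sectorGibbsWeightTT' β t (-t') U (2 - n) L)
        (fun L => sectorGibbsVectorTT' t (-t') U (2 - n) L) Ls' →
      ω'.meanEnergy (hubbardTTPrimeFermionInteraction 1 0 0) 1 ∈ Set.Icc lo hi)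
    (hLs : Tendsto Ls atTop atTop) (heven : ∀ᶠ j in atTop, Even (Ls j))
    (hadd : ∀ᶠ j in atTop, halfRectN (2 - n) (Ls j) + halfRectN n (Ls j) = Ls j ^ 2)
    (hω : ω.IsTorusLimitOfMixture (sectorGibbsCount n) (fun L => sectorGibbsWeightTT' β t t' U n L)
      (fun L => sectorGibbsVectorTT' t t' U n L) Ls) :
    ω.meanEnergy (hubbardTTPrimeFermionInteraction 1 0 0) 1 ∈ Set.Icc lo hi := by
  have h := hω.meanEnergy_mem_Icc_of_forall_image β t t' U hn0 hn2 1 0 0 hW hLs heven hadd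
  rwa [neg_zero, zero_mul, sub_zero, sub_zero] at h

/-- **Diagonal-hopping word, `T > 0`**: `K₂ ∈ [lo, hi]` over the image class ⇒ `K₂(ω) ∈ [-hi, -lo]`.
[cite: EsslerEtAl2005, §2.2.4 eqs. (2.59)–(2.61)] -/
theorem IsTorusLimitOfMixture.diagHopWord_mem_Icc_of_forall_image (β t t' U : ℝ) (hn0 : 0 ≤ n) (hn2 : n ≤ 2) {lo hi : ℝ}
    (hW : ∀ (Ls' : ℕ → ℕ) (ω' : InfVolFermionState 2), Tendsto Ls' atTop atTop →
      ω'.IsTorusLimitOfMixture (sectorGibbsCount (2 - n)) (fun L => sectorGibbsWeightTT' β t (-t') U (2 - n) L)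
        (fun L => sectorGibbsVectorTT' t (-t') U (2 - n) L) Ls' →
      ω'.meanEnergy (hubbardTTPrimeFermionInteraction 0 1 0) 1 ∈ Set.Icc lo hi)
    (hLs : Tendsto Ls atTop atTop) (heven : ∀ᶠ j in atTop, Even (Ls j))
    (hadd : ∀ᶠ j in atTop, halfRectN (2 - n) (Ls j) + halfRectN n (Ls j) = Ls j ^ 2)
    (hω : ω.IsTorusLimitOfMixture (sectorGibbsCount n) (fun L => sectorGibbsWeightTT' β t t' U n L)
      (fun L => sectorGibbsVectorTT' t t' U n L) Ls) :
    ω.meanEnergy (hubbardTTPrimeFermionInteraction 0 1 0) 1 ∈ Set.Icc (-hi) (-lo) := by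
  have h := hω.meanEnergy_mem_Icc_of_forall_image β t t' U hn0 hn2 0 1 0 hW hLs heven hadd
  rw [zero_mul, sub_zero, sub_zero, meanEnergy_zero_neg_one_zero] at h
  exact ⟨by linarith [h.2], by linarith [h.1]⟩

/-- **On-site word, `T > 0`**: `D ∈ [lo, hi]` over the image class ⇒ `D(ω) ∈ [lo - (1 - n), hi - (1 - n)]`.
[cite: EsslerEtAl2005, §2.2.4 eqs. (2.59)–(2.61)] -/
theorem IsTorusLimitOfMixture.onSiteWord_mem_Icc_of_forall_image (β t t' U : ℝ) (hn0 : 0 ≤ n) (hn2 : n ≤ 2) {lo hi : ℝ}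
    (hW : ∀ (Ls' : ℕ → ℕ) (ω' : InfVolFermionState 2), Tendsto Ls' atTop atTop →
      ω'.IsTorusLimitOfMixture (sectorGibbsCount (2 - n)) (fun L => sectorGibbsWeightTT' β t (-t') U (2 - n) L)
        (fun L => sectorGibbsVectorTT' t (-t') U (2 - n) L) Ls' →
      ω'.meanEnergy (hubbardTTPrimeFermionInteraction 0 0 1) 1 ∈ Set.Icc lo hi)
    (hLs : Tendsto Ls atTop atTop) (heven : ∀ᶠ j in atTop, Even (Ls j))
    (hadd : ∀ᶠ j in atTop, halfRectN (2 - n) (Ls j) + halfRectN n (Ls j) = Ls j ^ 2)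
    (hω : ω.IsTorusLimitOfMixture (sectorGibbsCount n) (fun L => sectorGibbsWeightTT' β t t' U n L)
      (fun L => sectorGibbsVectorTT' t t' U n L) Ls) :
    ω.meanEnergy (hubbardTTPrimeFermionInteraction 0 0 1) 1 ∈ Set.Icc (lo - (1 - n)) (hi - (1 - n)) := by
  have h := hω.meanEnergy_mem_Icc_of_forall_image β t t' U hn0 hn2 0 0 1 hW hLs heven hadd
  rwa [neg_zero, one_mul] at h

end Thermal

/-! ### §3 (appended) Instance-friendly forms: the image parameters as separate variables with equations

The producers' node files spell the image point with its own numerals (`t' = 1/4`, `n = 7/8`), while `-t'`, `2 - n` computed from the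
electron-doped class (`t' = -1/4`, `n = 9/8`) elaborate to `-(-1/4)`, `2 - 9/8`: the forms below take the image hopping `s'` and density `n'` as
variables with hypotheses `s' = -t'`, `n' = 2 - n` (discharged by `norm_num` at the instance), so an instance is one application. The word is the
class's OWN energy `e_{Φ(t,·,U)}` (the cells' currency); caps and floors separately, `T > 0` and `T = 0`. -/

section InstanceForms

variable {β t t' s' U : ℝ} {n n' : ℝ} {Ls : ℕ → ℕ} {ω : InfVolFermionState 2} {ψ : ∀ L, Fock (Orb (FermionTorus 2 L))}

/-- **CAP pull-back, `T > 0`, instance form**: `s' = -t'`, `n' = 2 - n`, `0 ≤ n ≤ 2`; a cap `e_{Φ(t,s',U)} ≤ c` over the canonical class at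
`(t, s', U, n', β)` (every `Ls'`) gives `e_{Φ(t,t',U)}(ω) ≤ c - U(1 - n)` for every torus limit `ω` of the canonical class at `(t, t', U, n, β)` along
eventually-even `Ls → ∞` with `halfRectN n' (Ls j) + halfRectN n (Ls j) = (Ls j)²`. [cite: LiebWuPhysicaA2003, §1 eq. (3)] -/
theorem IsTorusLimitOfMixture.meanEnergy_le_of_forall_image_cap (β t t' U : ℝ) (hs : s' = -t') (hn' : n' = 2 - n) (hn0 : 0 ≤ n) (hn2 : n ≤ 2)
    {c : ℝ}
    (hcap : ∀ (Ls' : ℕ → ℕ) (ω' : InfVolFermionState 2), Tendsto Ls' atTop atTop →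
      ω'.IsTorusLimitOfMixture (sectorGibbsCount n') (fun L => sectorGibbsWeightTT' β t s' U n' L)
        (fun L => sectorGibbsVectorTT' t s' U n' L) Ls' →
      ω'.meanEnergy (hubbardTTPrimeFermionInteraction t s' U) 1 ≤ c)
    (hLs : Tendsto Ls atTop atTop) (heven : ∀ᶠ j in atTop, Even (Ls j))
    (hadd : ∀ᶠ j in atTop, halfRectN n' (Ls j) + halfRectN n (Ls j) = Ls j ^ 2)
    (hω : ω.IsTorusLimitOfMixture (sectorGibbsCount n) (fun L => sectorGibbsWeightTT' β t t' U n L)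
      (fun L => sectorGibbsVectorTT' t t' U n L) Ls) :
    ω.meanEnergy (hubbardTTPrimeFermionInteraction t t' U) 1 ≤ c - U * (1 - n) := by
  subst hs hn'
  have himg : ω.particleHole.meanEnergy (hubbardTTPrimeFermionInteraction t (-t') U) 1 ≤ c :=
    hω.forall_particleHole_of_sectorGibbs β t t' U n
      (P := fun ω' => ω'.meanEnergy (hubbardTTPrimeFermionInteraction t (-t') U) 1 ≤ c) hcap hLs heven hadd
  have hid := hω.meanEnergy_particleHole_hubbardTTPrime_of_sectorGibbs β t t' U hn0 hn2 hLs heven t (-t') U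
  rw [neg_neg] at hid
  rw [hid] at himg
  linarith

/-- **FLOOR pull-back, `T > 0`, instance form**: a floor `c ≤ e_{Φ(t,s',U)}` over the image class gives `c - U(1 - n) ≤ e_{Φ(t,t',U)}(ω)`.
[cite: LiebWuPhysicaA2003, §1 eq. (3)] -/
theorem IsTorusLimitOfMixture.le_meanEnergy_of_forall_image_floor (β t t' U : ℝ) (hs : s' = -t') (hn' : n' = 2 - n) (hn0 : 0 ≤ n)
    (hn2 : n ≤ 2) {c : ℝ}
    (hfloor : ∀ (Ls' : ℕ → ℕ) (ω' : InfVolFermionState 2), Tendsto Ls' atTop atTop →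
      ω'.IsTorusLimitOfMixture (sectorGibbsCount n') (fun L => sectorGibbsWeightTT' β t s' U n' L)
        (fun L => sectorGibbsVectorTT' t s' U n' L) Ls' →
      c ≤ ω'.meanEnergy (hubbardTTPrimeFermionInteraction t s' U) 1)
    (hLs : Tendsto Ls atTop atTop) (heven : ∀ᶠ j in atTop, Even (Ls j))
    (hadd : ∀ᶠ j in atTop, halfRectN n' (Ls j) + halfRectN n (Ls j) = Ls j ^ 2)
    (hω : ω.IsTorusLimitOfMixture (sectorGibbsCount n) (fun L => sectorGibbsWeightTT' β t t' U n L)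
      (fun L => sectorGibbsVectorTT' t t' U n L) Ls) :
    c - U * (1 - n) ≤ ω.meanEnergy (hubbardTTPrimeFermionInteraction t t' U) 1 := by
  subst hs hn'
  have himg : c ≤ ω.particleHole.meanEnergy (hubbardTTPrimeFermionInteraction t (-t') U) 1 :=
    hω.forall_particleHole_of_sectorGibbs β t t' U n
      (P := fun ω' => c ≤ ω'.meanEnergy (hubbardTTPrimeFermionInteraction t (-t') U) 1) hfloor hLs heven hadd
  have hid := hω.meanEnergy_particleHole_hubbardTTPrime_of_sectorGibbs β t t' U hn0 hn2 hLs heven t (-t') U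
  rw [neg_neg] at hid
  rw [hid] at himg
  linarith

/-- **CAP pull-back, `T = 0`, instance form**: `s' = -t'`, `n' = 2 - n`, `0 ≤ n ≤ 2`; a cap `e_{Φ(t,s',U)} ≤ c` over the torus-limit ground states of
the record class at `(t, s', U, n')` (every `Ls'`) gives `e_{Φ(t,t',U)}(ω) ≤ c - U(1 - n)` over the record class at `(t, t', U, n)` along eventually-even
`Ls → ∞` with complementary sectors. [cite: LiebWuPhysicaA2003, §1 eq. (3)] -/
theorem IsTorusLimitOf.meanEnergy_le_of_forall_image_cap (t t' U : ℝ) (hs : s' = -t') (hn' : n' = 2 - n) (hn0 : 0 ≤ n) (hn2 : n ≤ 2) {c : ℝ}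
    (hcap : ∀ (ω' : InfVolFermionState 2) (Ls' : ℕ → ℕ) (ψ' : ∀ L, Fock (Orb (FermionTorus 2 L))),
      Tendsto Ls' atTop atTop →
      (∀ j, IsGroundStateInSector (hubbardTorusTT' (Ls' j) t s' U) (rectN n' (Ls' j)) 0 (ψ' (Ls' j))) →
      (∀ j, star (ψ' (Ls' j)) ⬝ᵥ ψ' (Ls' j) = 1) → ω'.IsTorusLimitOf ψ' Ls' →
      ω'.meanEnergy (hubbardTTPrimeFermionInteraction t s' U) 1 ≤ c)
    (hLs : Tendsto Ls atTop atTop) (heven : ∀ᶠ j in atTop, Even (Ls j))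
    (hadd : ∀ᶠ j in atTop, halfRectN n' (Ls j) + halfRectN n (Ls j) = Ls j ^ 2)
    (hψ : ∀ j, IsGroundStateInSector (hubbardTorusTT' (Ls j) t t' U) (rectN n (Ls j)) 0 (ψ (Ls j)))
    (h1 : ∀ j, star (ψ (Ls j)) ⬝ᵥ ψ (Ls j) = 1) (hω : ω.IsTorusLimitOf ψ Ls) :
    ω.meanEnergy (hubbardTTPrimeFermionInteraction t t' U) 1 ≤ c - U * (1 - n) := by
  subst hs hn'
  have himg : ω.particleHole.meanEnergy (hubbardTTPrimeFermionInteraction t (-t') U) 1 ≤ c :=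
    hω.forall_particleHole_of_sectorGroundStates t t' U hn0 hn2
      (P := fun ω' => ω'.meanEnergy (hubbardTTPrimeFermionInteraction t (-t') U) 1 ≤ c) hcap hLs heven hadd hψ h1
  have hid := hω.meanEnergy_particleHole_hubbardTTPrime_of_sectorGroundStates t t' U hn0 hLs hψ h1 heven t (-t') U
  rw [neg_neg] at hid
  rw [hid] at himg
  linarith

/-- **FLOOR pull-back, `T = 0`, instance form**: a floor `c ≤ e_{Φ(t,s',U)}` over the image record class gives `c - U(1 - n) ≤ e_{Φ(t,t',U)}(ω)`.
[cite: LiebWuPhysicaA2003, §1 eq. (3)] -/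
theorem IsTorusLimitOf.le_meanEnergy_of_forall_image_floor (t t' U : ℝ) (hs : s' = -t') (hn' : n' = 2 - n) (hn0 : 0 ≤ n) (hn2 : n ≤ 2) {c : ℝ}
    (hfloor : ∀ (ω' : InfVolFermionState 2) (Ls' : ℕ → ℕ) (ψ' : ∀ L, Fock (Orb (FermionTorus 2 L))),
      Tendsto Ls' atTop atTop →
      (∀ j, IsGroundStateInSector (hubbardTorusTT' (Ls' j) t s' U) (rectN n' (Ls' j)) 0 (ψ' (Ls' j))) →
      (∀ j, star (ψ' (Ls' j)) ⬝ᵥ ψ' (Ls' j) = 1) → ω'.IsTorusLimitOf ψ' Ls' →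
      c ≤ ω'.meanEnergy (hubbardTTPrimeFermionInteraction t s' U) 1)
    (hLs : Tendsto Ls atTop atTop) (heven : ∀ᶠ j in atTop, Even (Ls j))
    (hadd : ∀ᶠ j in atTop, halfRectN n' (Ls j) + halfRectN n (Ls j) = Ls j ^ 2)
    (hψ : ∀ j, IsGroundStateInSector (hubbardTorusTT' (Ls j) t t' U) (rectN n (Ls j)) 0 (ψ (Ls j)))
    (h1 : ∀ j, star (ψ (Ls j)) ⬝ᵥ ψ (Ls j) = 1) (hω : ω.IsTorusLimitOf ψ Ls) :
    c - U * (1 - n) ≤ ω.meanEnergy (hubbardTTPrimeFermionInteraction t t' U) 1 := by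
  subst hs hn'
  have himg : c ≤ ω.particleHole.meanEnergy (hubbardTTPrimeFermionInteraction t (-t') U) 1 :=
    hω.forall_particleHole_of_sectorGroundStates t t' U hn0 hn2
      (P := fun ω' => c ≤ ω'.meanEnergy (hubbardTTPrimeFermionInteraction t (-t') U) 1) hfloor hLs heven hadd hψ h1
  have hid := hω.meanEnergy_particleHole_hubbardTTPrime_of_sectorGroundStates t t' U hn0 hLs hψ h1 heven t (-t') U
  rw [neg_neg] at hid
  rw [hid] at himg
  linarith

/-- **Generic coordinate-word pull-back, `T > 0`, instance form**: for any word `(a, b, c)` with image word `(a, b', c)`, `b' = -b`: a cap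
`e_{Φ(a,b',c)} ≤ k` over the image class gives `e_{Φ(a,b,c)}(ω) ≤ k - c(1 - n)` over the original class (`(1,0,0)`: `K₁ ≤ k`; `(0,1,0)` with
`b' = -1`: `K₂ ≤ k` from `e_{Φ(0,-1,0)} ≤ k`; `(0,0,1)`: `D ≤ k - (1 - n)`). [cite: EsslerEtAl2005, §2.2.4 eqs. (2.59)–(2.61)] -/
theorem IsTorusLimitOfMixture.meanEnergy_word_le_of_forall_image_cap (β t t' U : ℝ) (hs : s' = -t') (hn' : n' = 2 - n) (hn0 : 0 ≤ n)
    (hn2 : n ≤ 2) (a b c : ℝ) {b' : ℝ} (hb : b' = -b) {k : ℝ}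
    (hcap : ∀ (Ls' : ℕ → ℕ) (ω' : InfVolFermionState 2), Tendsto Ls' atTop atTop →
      ω'.IsTorusLimitOfMixture (sectorGibbsCount n') (fun L => sectorGibbsWeightTT' β t s' U n' L)
        (fun L => sectorGibbsVectorTT' t s' U n' L) Ls' →
      ω'.meanEnergy (hubbardTTPrimeFermionInteraction a b' c) 1 ≤ k)
    (hLs : Tendsto Ls atTop atTop) (heven : ∀ᶠ j in atTop, Even (Ls j))
    (hadd : ∀ᶠ j in atTop, halfRectN n' (Ls j) + halfRectN n (Ls j) = Ls j ^ 2)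
    (hω : ω.IsTorusLimitOfMixture (sectorGibbsCount n) (fun L => sectorGibbsWeightTT' β t t' U n L)
      (fun L => sectorGibbsVectorTT' t t' U n L) Ls) :
    ω.meanEnergy (hubbardTTPrimeFermionInteraction a b c) 1 ≤ k - c * (1 - n) := by
  subst hs hn' hb
  have himg : ω.particleHole.meanEnergy (hubbardTTPrimeFermionInteraction a (-b) c) 1 ≤ k :=
    hω.forall_particleHole_of_sectorGibbs β t t' U n
      (P := fun ω' => ω'.meanEnergy (hubbardTTPrimeFermionInteraction a (-b) c) 1 ≤ k) hcap hLs heven hadd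
  have hid := hω.meanEnergy_particleHole_hubbardTTPrime_of_sectorGibbs β t t' U hn0 hn2 hLs heven a (-b) c
  rw [neg_neg] at hid
  rw [hid] at himg
  linarith

/-- **Generic coordinate-word pull-back, `T = 0`, instance form** (same shape over the record ground-state classes).
[cite: EsslerEtAl2005, §2.2.4 eqs. (2.59)–(2.61)] -/
theorem IsTorusLimitOf.meanEnergy_word_le_of_forall_image_cap (t t' U : ℝ) (hs : s' = -t') (hn' : n' = 2 - n) (hn0 : 0 ≤ n) (hn2 : n ≤ 2)
    (a b c : ℝ) {b' : ℝ} (hb : b' = -b) {k : ℝ}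
    (hcap : ∀ (ω' : InfVolFermionState 2) (Ls' : ℕ → ℕ) (ψ' : ∀ L, Fock (Orb (FermionTorus 2 L))),
      Tendsto Ls' atTop atTop →
      (∀ j, IsGroundStateInSector (hubbardTorusTT' (Ls' j) t s' U) (rectN n' (Ls' j)) 0 (ψ' (Ls' j))) →
      (∀ j, star (ψ' (Ls' j)) ⬝ᵥ ψ' (Ls' j) = 1) → ω'.IsTorusLimitOf ψ' Ls' →
      ω'.meanEnergy (hubbardTTPrimeFermionInteraction a b' c) 1 ≤ k)
    (hLs : Tendsto Ls atTop atTop) (heven : ∀ᶠ j in atTop, Even (Ls j))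
    (hadd : ∀ᶠ j in atTop, halfRectN n' (Ls j) + halfRectN n (Ls j) = Ls j ^ 2)
    (hψ : ∀ j, IsGroundStateInSector (hubbardTorusTT' (Ls j) t t' U) (rectN n (Ls j)) 0 (ψ (Ls j)))
    (h1 : ∀ j, star (ψ (Ls j)) ⬝ᵥ ψ (Ls j) = 1) (hω : ω.IsTorusLimitOf ψ Ls) :
    ω.meanEnergy (hubbardTTPrimeFermionInteraction a b c) 1 ≤ k - c * (1 - n) := by
  subst hs hn' hb
  have himg : ω.particleHole.meanEnergy (hubbardTTPrimeFermionInteraction a (-b) c) 1 ≤ k :=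
    hω.forall_particleHole_of_sectorGroundStates t t' U hn0 hn2
      (P := fun ω' => ω'.meanEnergy (hubbardTTPrimeFermionInteraction a (-b) c) 1 ≤ k) hcap hLs heven hadd hψ h1
  have hid := hω.meanEnergy_particleHole_hubbardTTPrime_of_sectorGroundStates t t' U hn0 hLs hψ h1 heven a (-b) c
  rw [neg_neg] at hid
  rw [hid] at himg
  linarith

end InstanceForms

end InfVolFermionState

end Literature.MathematicalPhysics.QuantumLattice
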